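import Literature.Probability.Percolation.OneArmFromNeumann
import Literature.Probability.Percolation.OneArmAnnulusCrossingProofs
import HarnessLib

/-!
# LSW Theorem 1.2 (and (3.1)) from Neumann flatness of the renewal extension (proofs only)

Topic `Literature/Probability/Percolation`; family `crit-perc`. Def-free, fact-free companion of
`OneArmScalingLimit.lean`, the home of the named fact
`Literature.Probability.Percolation.LawlerSchrammWerner2002_scalingLimitExponent` — Lawler–
Schramm–Werner, *One-arm exponent for critical 2D percolation*, Electron. J. Probab. **7**
(2002), paper no. 2, **Theorem 1.2** (p. 2): for every weak limit `ν` of the laws `lswLaw R` of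
LSW's sets `Q_{1/R}` there is `c > 0` with `c⁻¹ r^{5/48} ≤ ν{dist(0, K) < r} ≤ c r^{5/48}` for
`r ∈ (0, 1/2)`.

State of the tree (2026-08-15). The renewal line `RadialBessel*.lean` → `OneArmRenewal.lean` →
`OneArmFromNeumann.lean` derives the whole of LSW §2 EXCEPT the reflection condition at
`θ = 2π` from the radial Bessel SDE `dY = cot(Y/2) dt - √κ dB` ((2.11)): for antitone data
`u : ℝ → [0, 1]` the renewal extension `g = renewalST κ V U` of the twice time-averaged data
`U = dataU u`, `V = dataV` (LSW's (2.10) read as a DEFINITION of `g` on `(0, 2π)`) is continuous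
on the closed strip, `C^{2,1}` inside, solves the PDE (2.4), has Dirichlet data `0` at `θ = 0`
and `U` at `θ = 2π`; THEOREM A (`LawlerSchrammWerner2002_exp_bounds_of_neumann`) then gives
LSW's two-sided exponential bounds `u(t) ≍ e^{-λt}` from the comparison (2.17) PROVIDED `g` is
Neumann-flat at `2π`, and THEOREM B (`oneArm_exponent_of_neumannRenewal`,
`oneArm_exponent_of_neumannFlat`) concludes the one-arm exponent (Thm. 1.1), the lower bound
`u(3) ≥ m₀ > 0` uniform over subsequential limits being PROVED (RSW + Koebe,
`exists_lower_bound_confRad_subseqLimits`). This file threads the same residual hypothesis —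
**Neumann flatness at `2π` of the renewal extension of `dataU w_ν`,
`w_ν(t) = ν{K | 𝔯(K) ≤ e^{-t}}`** (LSW's `∂_θ h̃(2π, t) = 0`, Lemma 2.3, for the function that
(2.10) makes of `h(2π, ·)`) — to Theorem 1.2 and to (3.1):

* `exists_measure_bounds_of_neumannFlat` — the step buried in the proof of THEOREM B, exposed:
  ONE constant `C > 0` such that for every weak limit `ν` of `lswLaw (R_k)`, `R_k → ∞`, whose
  renewal extension is Neumann-flat at `2π`,
  `C⁻¹ r^{5/48} ≤ ν{dist(0, K) < r}` and `ν{dist(0, K) ≤ r} ≤ C r^{5/48}` for `r ∈ (0, 1/2)`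
  (THEOREM A at `κ = 6`, `λ(6) = 5/48`, then Koebe: `measure_bounds_of_exp_bounds`);
* `LawlerSchrammWerner2002_thm_1_2_of_neumannFlat` — hence **Theorem 1.2 for every such `ν`**;
* `LawlerSchrammWerner2002_scalingLimitExponent_of_neumannFlat` — the named fact from Neumann
  flatness at the full weak limits `ν` of `lswLaw` (`R → ∞` through `ℝ`; specialise to
  `R_k = k`);
* `LawlerSchrammWerner2002_annulusCrossing_of_neumannFlat_of_tendsto`,
  `LawlerSchrammWerner2002_annulusCrossing_of_scalingLimit_of_neumannFlat` — and the sibling fact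
  `LawlerSchrammWerner2002_annulusCrossing` (Thm. 1.2 with (3.1)) from Neumann flatness at all
  subsequential limits plus radial convergence of `P[C(rR, R)]` off a countable set of radii
  (resp. plus the existence of the weak limit of `lswLaw`), through
  `crossingBounds_of_subseqLimits` and
  `LawlerSchrammWerner2002_annulusCrossing_of_crossingBounds_of_tendsto`.

Compared with `LawlerSchrammWerner2002_scalingLimitExponent_of_hittingPDE` /
`…_of_subseqTrace` (`OneArmHittingPDEProofs.lean`, `OneArmFromTrace.lean`), no datum
`(h, h_θ, h_θθ, h_t)`, no PDE, no regularity, no Dirichlet condition and no identification with the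
series solution `lswHit 6` is assumed: only the one boundary condition at `2π`.

What is NOT here: no discharge. Neumann flatness of the renewal extension is a property of the
datum `w_ν`, not of the diffusion (for a general antitone datum the extension is NOT Neumann-flat:
`P^θ[Y_T = 0] ≍ (2π - θ)^{1 - 4/κ}` by the scale function, `measureReal_sleExitsTop_eq`); for
`w_ν` it is LSW's Lemma 2.3 applied to the arc-hitting function `h(θ, t) = P[𝔯(θ) ≤ e^{-t}]`
AFTER the identification (2.10) `h = renewal extension of h(2π, ·)`, i.e. after Smirnov's theorem
in the form of LSW's Thm. 2.1 and the radial `SLE₆` description (2.5)–(2.9) of `Q(θ)` — the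
content of the named fact `LawlerSchrammWerner2002_hittingPDE`, resting on the unproved
`convergesInLawToSLE_six_triInterface` (`InterfaceScalingLimit.lean`); the percolation estimate
(2.13) of Lemma 2.3 is proved (`LawlerSchrammWerner2002_halfPlane_threeArm`,
`HalfPlaneThreeArm.lean`), the harmonic-measure and conformal-radius estimates (2.14)–(2.16) are
not. No new definitions, no new named facts.

## References

* G. F. Lawler, O. Schramm, W. Werner, *One-arm exponent for critical 2D percolation*, Electron.
  J. Probab. 7 (2002), no. 2 — Thm. 1.2 (p. 2), §2 ((2.10), Lemma 2.2, Lemma 2.3, (2.17)),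
  §3 (3.1) (p. 8) [LawlerSchrammWernerEJP2002].

## Mathlib / tree

Tree: `LawlerSchrammWerner2002_exp_bounds_of_neumann`, `measure_bounds_of_exp_bounds`
(`OneArmRenewal.lean`), `exists_lower_bound_confRad_subseqLimits` (`OneArmLowerBound.lean`),
`crossingBounds_of_subseqLimits` (`OneArmSubsequentialLimits.lean`),
`LawlerSchrammWerner2002_annulusCrossing_of_crossingBounds_of_tendsto`,
`exists_mem_Icc_tendsto_real_triOpenCrossing`, `tendsto_real_triOpenCrossing_of_scalingLimit`
(`OneArmAnnulusCrossingProofs.lean`), `koebeCovering_const`, `lswLambda_six`.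
-/

noncomputable section

open MeasureTheory Filter Topology Set TopologicalSpace
open scoped NNReal
open Literature.Probability.LatticeModels
open Literature.Probability.RandomPlanarGeometry Literature.Probability.RandomPlanarGeometry.RadialLoewner
open Literature.Probability.Process

namespace Literature.Probability.Percolation

/-! ### Uniform two-sided measure bounds at Neumann-flat subsequential limits -/

/-- **Uniform Theorem 1.2 bounds at Neumann-flat subsequential limits.** There is ONE constant
`C > 0` such that for every weak limit `ν` of `lswLaw (R_k)` along `R_k → ∞` whose renewal
extension `θ ↦ renewalST 6 V (avg(avg w_ν)) θ t`, `w_ν(t) = ν{K | 𝔯(K) ≤ e^{-t}}`, has vanishing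
left `θ`-derivative at `2π` for every `t > 0` (LSW's Neumann condition, Lemma 2.3), and every
`r ∈ (0, 1/2)`: `C⁻¹ r^{5/48} ≤ ν{dist(0, K) < r}` and `ν{dist(0, K) ≤ r} ≤ C r^{5/48}`. Proof:
`w_ν` is antitone with values in `[0, 1]` and `w_ν(3) ≥ m₀ > 0` uniformly
(`exists_lower_bound_confRad_subseqLimits`), so THEOREM A
(`LawlerSchrammWerner2002_exp_bounds_of_neumann`, `κ = 6`, `λ(6) = 5/48`) gives exponential
bounds with constants depending on `m₀` only, and Koebe (`measure_bounds_of_exp_bounds`,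
`koebeCovering_const`) converts them. [cite: LawlerSchrammWernerEJP2002, Thm. 1.2 and its proof (pp. 2, 8)] -/
theorem exists_measure_bounds_of_neumannFlat :
    ∃ C : ℝ, 0 < C ∧ ∀ (R : ℕ → ℝ) (ν : ProbabilityMeasure (NonemptyCompacts ℂ)),
      Tendsto R atTop atTop → Tendsto (lswLaw ∘ R) atTop (𝓝 ν) →
      (∀ t, 0 < t → HasDerivWithinAt (fun x ↦ renewalST 6 dataV
          (dataU fun s ↦ (ν : Measure (NonemptyCompacts ℂ)).real
            {K | Literature.Analysis.Complex.conformalRadius (K : Set ℂ) ≤ Real.exp (-s)}) x t)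
          0 (Iic (2 * Real.pi)) (2 * Real.pi)) →
      ∀ r : ℝ, 0 < r → r < 1 / 2 →
        C⁻¹ * r ^ (5 / 48 : ℝ) ≤ (ν : Measure (NonemptyCompacts ℂ)).real (meetsBall r) ∧
          (ν : Measure (NonemptyCompacts ℂ)).real (meetsClosedBall r) ≤ C * r ^ (5 / 48 : ℝ) := by
  obtain ⟨m₀, hm₀, hlow⟩ := exists_lower_bound_confRad_subseqLimits
  have h6 : (4 : ℝ≥0) < 6 := by norm_num
  have hlam : lswLambda ((6 : ℝ≥0) : ℝ) = 5 / 48 := by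
    rw [show ((6 : ℝ≥0) : ℝ) = 6 by norm_num]; exact lswLambda_six
  -- `w_ν` is antitone with values in `[0, 1]`
  have hw : ∀ ν : ProbabilityMeasure (NonemptyCompacts ℂ),
      Antitone (fun s ↦ (ν : Measure (NonemptyCompacts ℂ)).real
        {K | Literature.Analysis.Complex.conformalRadius (K : Set ℂ) ≤ Real.exp (-s)}) ∧
      ∀ s, (ν : Measure (NonemptyCompacts ℂ)).real
        {K | Literature.Analysis.Complex.conformalRadius (K : Set ℂ) ≤ Real.exp (-s)} ∈ Icc (0 : ℝ) 1 := by
    intro ν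
    refine ⟨fun a b hab ↦ measureReal_mono (fun K hK ↦ ?_) (measure_ne_top _ _),
      fun s ↦ ⟨measureReal_nonneg, measureReal_le_one⟩⟩
    have hK' : Literature.Analysis.Complex.conformalRadius (K : Set ℂ) ≤ Real.exp (-b) := hK
    show Literature.Analysis.Complex.conformalRadius (K : Set ℂ) ≤ Real.exp (-a)
    exact hK'.trans (Real.exp_le_exp.2 (by linarith))
  have hπ := Real.pi_gt_three
  have hp₁0 : 0 < preWienerMeasure.real (sleExitsTop 6 1) := measureReal_sleExitsTop_one_pos h6
  have hmp : 0 < m₀ * preWienerMeasure.real (sleExitsTop 6 1) := mul_pos hm₀ hp₁0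
  have hc₂0 : 0 < (1 + Real.pi ^ 2) / (m₀ * preWienerMeasure.real (sleExitsTop 6 1)) +
      Real.pi ^ 2 / (m₀ * preWienerMeasure.real (sleExitsTop 6 1)) +
      1 / (m₀ * preWienerMeasure.real (sleExitsTop 6 1)) := by positivity
  have hA0 : 0 < Real.sin (Real.pi / 4) ^ lswQ ((6 : ℝ≥0) : ℝ) * Real.exp (-(5 / 48 * 1)) :=
    mul_pos (Real.rpow_pos_of_pos (sin_quarter_pos Real.pi_pos (by linarith)) _) (Real.exp_pos _)
  have hB0 : 0 < Real.sin (1 / 4) ^ lswQ ((6 : ℝ≥0) : ℝ) * Real.exp (-(5 / 48 * 0)) :=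
    mul_pos (Real.rpow_pos_of_pos (sin_quarter_pos one_pos (by linarith)) _) (Real.exp_pos _)
  have hc₁0 : 0 < ((1 + Real.pi ^ 2) / (Real.sin (Real.pi / 4) ^ lswQ ((6 : ℝ≥0) : ℝ) * Real.exp (-(5 / 48 * 1))) +
      Real.pi ^ 2 / (Real.sin (1 / 4) ^ lswQ ((6 : ℝ≥0) : ℝ) * Real.exp (-(5 / 48 * 0)))) *
      Real.exp (2 * (5 / 48)) :=
    mul_pos (add_pos (div_pos (by positivity) hA0) (div_pos (by positivity) hB0)) (Real.exp_pos _)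
  obtain ⟨C, hC, hb⟩ := measure_bounds_of_exp_bounds koebeCovering_const (by positivity)
    (inv_pos.2 hc₂0) hc₁0
  refine ⟨C, hC, fun R ν hR hν hneu ↦ hb ν ?_ ?_⟩
  · -- lower exponential bound (THEOREM A, first half)
    intro t ht
    have hA := LawlerSchrammWerner2002_exp_bounds_of_neumann h6 (hw ν).1 (hw ν).2 hm₀
      (by simpa using hlow R ν hR hν) hneu
    rw [hlam] at hA
    rw [inv_mul_eq_div]
    exact hA.1 t ht
  · -- upper exponential bound (THEOREM A, second half)
    intro t ht
    have hA := LawlerSchrammWerner2002_exp_bounds_of_neumann h6 (hw ν).1 (hw ν).2 hm₀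
      (by simpa using hlow R ν hR hν) hneu
    rw [hlam] at hA
    refine (hA.2 t ht).trans (le_of_eq ?_)
    rw [show -(5 / 48 * (t - 2)) = 2 * (5 / 48) + -(5 / 48 * t) by ring, Real.exp_add]
    ring

/-! ### Theorem 1.2 -/

/-- **LSW Theorem 1.2 at a Neumann-flat subsequential limit.** If `ν` is a weak limit of
`lswLaw (R_k)`, `R_k → ∞`, and the renewal extension of `avg(avg w_ν)` is Neumann-flat at `2π`
for every `t > 0`, then there is `c > 0` with `c⁻¹ r^{5/48} ≤ ν{dist(0, K) < r} ≤ c r^{5/48}` for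
all `r ∈ (0, 1/2)` (the constant is even independent of `ν`,
`exists_measure_bounds_of_neumannFlat`; `{dist < r} ⊆ {dist ≤ r}`).
[cite: LawlerSchrammWernerEJP2002, Thm. 1.2 (p. 2)] -/
theorem LawlerSchrammWerner2002_thm_1_2_of_neumannFlat {R : ℕ → ℝ}
    {ν : ProbabilityMeasure (NonemptyCompacts ℂ)} (hR : Tendsto R atTop atTop)
    (hν : Tendsto (lswLaw ∘ R) atTop (𝓝 ν))
    (hneu : ∀ t, 0 < t → HasDerivWithinAt (fun x ↦ renewalST 6 dataV
      (dataU fun s ↦ (ν : Measure (NonemptyCompacts ℂ)).real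
        {K | Literature.Analysis.Complex.conformalRadius (K : Set ℂ) ≤ Real.exp (-s)}) x t)
      0 (Iic (2 * Real.pi)) (2 * Real.pi)) :
    ∃ c : ℝ, 0 < c ∧ ∀ r : ℝ, 0 < r → r < 1 / 2 →
      c⁻¹ * r ^ (5 / 48 : ℝ) ≤ (ν : Measure (NonemptyCompacts ℂ)).real (meetsBall r) ∧
        (ν : Measure (NonemptyCompacts ℂ)).real (meetsBall r) ≤ c * r ^ (5 / 48 : ℝ) := by
  obtain ⟨C, hC, hb⟩ := exists_measure_bounds_of_neumannFlat
  refine ⟨C, hC, fun r hr0 hr2 ↦ ⟨(hb R ν hR hν hneu r hr0 hr2).1, ?_⟩⟩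
  exact (measureReal_mono (meetsBall_subset_meetsClosedBall r) (measure_ne_top _ _)).trans
    (hb R ν hR hν hneu r hr0 hr2).2

/-- **The named fact `LawlerSchrammWerner2002_scalingLimitExponent` from Neumann flatness at the
scaling limit.** If for every weak limit `ν` of `lswLaw R` as `R → ∞` (through `ℝ`) and every
`t > 0` the renewal extension of `avg(avg w_ν)` is Neumann-flat at `2π`, then LSW's Theorem 1.2
holds for every such `ν` (specialise `exists_measure_bounds_of_neumannFlat` to `R_k = k`). So the
discharge `LawlerSchrammWerner2002_scalingLimitExponent_holds` is exactly this reflection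
condition (LSW Lemma 2.3 after the identification (2.10)), nothing else of §2 being assumed.
[cite: LawlerSchrammWernerEJP2002, Thm. 1.2 (p. 2), Lemma 2.3] -/
theorem LawlerSchrammWerner2002_scalingLimitExponent_of_neumannFlat
    (hneu : ∀ ν : ProbabilityMeasure (NonemptyCompacts ℂ), Tendsto lswLaw atTop (𝓝 ν) →
      ∀ t, 0 < t → HasDerivWithinAt (fun x ↦ renewalST 6 dataV
        (dataU fun s ↦ (ν : Measure (NonemptyCompacts ℂ)).real
          {K | Literature.Analysis.Complex.conformalRadius (K : Set ℂ) ≤ Real.exp (-s)}) x t)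
        0 (Iic (2 * Real.pi)) (2 * Real.pi)) :
    LawlerSchrammWerner2002_scalingLimitExponent := by
  intro ν hν
  exact LawlerSchrammWerner2002_thm_1_2_of_neumannFlat (R := fun k : ℕ ↦ (k : ℝ))
    tendsto_natCast_atTop_atTop (hν.comp tendsto_natCast_atTop_atTop) (hneu ν hν)

/-- The same from the (formally stronger) hypothesis at all subsequential limits, the form in
which `oneArm_exponent_of_neumannFlat` consumes it. [cite: LawlerSchrammWernerEJP2002, Thm. 1.2 (p. 2)] -/
theorem LawlerSchrammWerner2002_scalingLimitExponent_of_neumannFlat_subseq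
    (hneu : ∀ (R : ℕ → ℝ) (ν : ProbabilityMeasure (NonemptyCompacts ℂ)),
      Tendsto R atTop atTop → Tendsto (lswLaw ∘ R) atTop (𝓝 ν) →
        ∀ t, 0 < t → HasDerivWithinAt (fun x ↦ renewalST 6 dataV
          (dataU fun s ↦ (ν : Measure (NonemptyCompacts ℂ)).real
            {K | Literature.Analysis.Complex.conformalRadius (K : Set ℂ) ≤ Real.exp (-s)}) x t)
          0 (Iic (2 * Real.pi)) (2 * Real.pi)) :
    LawlerSchrammWerner2002_scalingLimitExponent :=
  LawlerSchrammWerner2002_scalingLimitExponent_of_neumannFlat fun ν hν ↦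
    hneu (fun k : ℕ ↦ (k : ℝ)) ν tendsto_natCast_atTop_atTop (hν.comp tendsto_natCast_atTop_atTop)

/-! ### Theorem 1.2 with (3.1): the sibling fact `LawlerSchrammWerner2002_annulusCrossing` -/

/-- **LSW's Thm. 1.2 + (3.1) from Neumann flatness and radial convergence.** If the renewal
extension of `avg(avg w_ν)` is Neumann-flat at `2π` for every weak limit `ν` of `lswLaw (R_k)`,
`R_k → ∞`, and the one-arm annulus probabilities `P[C(rR, R)]` converge as `R → ∞` for all radii
`r ∈ (0, 1)` off a countable set `N`, then `LawlerSchrammWerner2002_annulusCrossing` holds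
(uniform bounds `exists_measure_bounds_of_neumannFlat`, then `crossingBounds_of_subseqLimits`
and `LawlerSchrammWerner2002_annulusCrossing_of_crossingBounds_of_tendsto`).
[cite: LawlerSchrammWernerEJP2002, Thm. 1.2 (p. 2), §3 (3.1) (p. 8)] -/
theorem LawlerSchrammWerner2002_annulusCrossing_of_neumannFlat_of_tendsto
    (hneu : ∀ (R : ℕ → ℝ) (ν : ProbabilityMeasure (NonemptyCompacts ℂ)),
      Tendsto R atTop atTop → Tendsto (lswLaw ∘ R) atTop (𝓝 ν) →
        ∀ t, 0 < t → HasDerivWithinAt (fun x ↦ renewalST 6 dataV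
          (dataU fun s ↦ (ν : Measure (NonemptyCompacts ℂ)).real
            {K | Literature.Analysis.Complex.conformalRadius (K : Set ℂ) ≤ Real.exp (-s)}) x t)
          0 (Iic (2 * Real.pi)) (2 * Real.pi))
    {N : Set ℝ} (hN : N.Countable)
    (hconv : ∀ r : ℝ, 0 < r → r < 1 → r ∉ N → ∃ c : ℝ,
      Tendsto (fun R : ℝ => (triSitePercolation half).real (triOpenCrossing (r * R) R))
        atTop (𝓝 c)) :
    LawlerSchrammWerner2002_annulusCrossing := by
  obtain ⟨C, hC, hb⟩ := exists_measure_bounds_of_neumannFlat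
  have hlim : ∀ (R : ℕ → ℝ) (ν : ProbabilityMeasure (NonemptyCompacts ℂ)),
      Tendsto R atTop atTop → Tendsto (lswLaw ∘ R) atTop (𝓝 ν) →
        ∀ r : ℝ, 0 < r → r < 1 / 2 →
          C⁻¹ * r ^ (5 / 48 : ℝ) ≤ (ν : Measure (NonemptyCompacts ℂ)).real (meetsBall r) ∧
            (ν : Measure (NonemptyCompacts ℂ)).real (meetsClosedBall r) ≤ C * r ^ (5 / 48 : ℝ) :=
    fun R ν hR hν ↦ hb R ν hR hν (hneu R ν hR hν)
  exact LawlerSchrammWerner2002_annulusCrossing_of_crossingBounds_of_tendsto hC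
    (fun r hr0 hr2 ↦ crossingBounds_of_subseqLimits hC hlim hr0 hr2)
    (fun r hr0 hr2 ↦ exists_mem_Icc_tendsto_real_triOpenCrossing hN hconv hr0 (by linarith))

/-- **Existence of the scaling limit + Neumann flatness ⇒ `annulusCrossing`**: the weak limit
(hypothesis `hsl`, LSW §2, p. 3: "the limit exists") supplies radial convergence off the countable
set of atoms of `dist(0, K)`
(`tendsto_real_triOpenCrossing_of_scalingLimit`). [cite: LawlerSchrammWernerEJP2002, Thm. 1.2 (p. 2), §3 (3.1) (p. 8)] -/
theorem LawlerSchrammWerner2002_annulusCrossing_of_scalingLimit_of_neumannFlat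
    (hsl : ∃ ν : ProbabilityMeasure (NonemptyCompacts ℂ), Tendsto lswLaw atTop (𝓝 ν))
    (hneu : ∀ (R : ℕ → ℝ) (ν : ProbabilityMeasure (NonemptyCompacts ℂ)),
      Tendsto R atTop atTop → Tendsto (lswLaw ∘ R) atTop (𝓝 ν) →
        ∀ t, 0 < t → HasDerivWithinAt (fun x ↦ renewalST 6 dataV
          (dataU fun s ↦ (ν : Measure (NonemptyCompacts ℂ)).real
            {K | Literature.Analysis.Complex.conformalRadius (K : Set ℂ) ≤ Real.exp (-s)}) x t)
          0 (Iic (2 * Real.pi)) (2 * Real.pi)) :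
    LawlerSchrammWerner2002_annulusCrossing := by
  obtain ⟨N, hN, hconv⟩ := tendsto_real_triOpenCrossing_of_scalingLimit hsl
  exact LawlerSchrammWerner2002_annulusCrossing_of_neumannFlat_of_tendsto hneu hN hconv

end Literature.Probability.Percolation
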